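import Summits.BirchSwinnertonDyer.BirchSwinnertonDyer.Theses.SignedLowerHalves
import Summits.BirchSwinnertonDyer.Rank1Residual.Supersingular.KobayashiEquivalenceRankZero
import Summits.BirchSwinnertonDyer.Rank1Residual.Supersingular.KobayashiMainConjecture
import Literature.NumberTheory.EllipticCurves.Rank1Residual.Typed.X7
import Literature.NumberTheory.EllipticCurves.KuriharaNumberInvariants
import Literature.NumberTheory.EllipticCurves.Tamagawa
import HarnessLib

/-!
# Crux `KobayashiLowerHalfLargeImage` (item stmt-BirchSwinnertonDyer-19001), line `kurihara_rigidity`: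
# the RANK CUT — the route's deciding theorem consumes crux 3 ONLY at analytic rank `≤ 1`, and its
# analytic-rank-`0` slice is EXACTLY the leaf's own `BSD(E,p)` clause (cell `bsd-ssimc`, seat
# `bsd-line-slh-p1`, lead of the line, gen 3; a `--supports … --as helper` file, closes nothing)

HONEST FRAMING (D-0152): theorems only; the leaf `SignedSupersingular` and every route item stay OPEN;
every theorem is bookkeeping over the tree's landed class roads, CONDITIONAL on the route's own support item
`PublishedSignedInputs` where published facts are consumed; BSD is not proved by any of this.

WHAT. The route decl `KobayashiLowerHalfLargeImage` (crux 3) quantifies over EVERY analytic rank, but the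
rung-K3 leaf `Summit.BirchSwinnertonDyer.Rank1Residual.Supersingular.SignedSupersingular` it serves quantifies
`W.analyticRank ≤ 1`, and the landed bridge `SignedSupersingular.signedSupersingular_of_lowerHalves`
(p405667) applies crux 3 only at the pair `(W, p)` under that bound. This file records the consequences
in the kernel, with the route decls BY NAME:

* §1 `signedSupersingular_of_lowerHalves_largeImage_rankLeOne` — the leaf from the five OTHER route items
  (`KobayashiLowerHalfSemistable`, `KobayashiMainConjectureSmallImage`, `SprungLowerHalfAtThree`,
  `SharpFlatResiduePPart`, `PublishedSignedInputs`, by name) and crux 3 RESTRICTED to `W.analyticRank ≤ 1`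
  (the registered signature with ONE extra trailing binder). So the `r_an ≥ 2` part of item 19001 is idle in
  `closes`; `kobayashiLowerHalfLargeImage_rankLeOne_of_crux` is the trivial converse bookkeeping.
* §2 `largeImage_rankZero_iff_bsdp` — granted `PublishedSignedInputs` (+ the tree THEOREMS
  `pollack_exists_plusMinusPAdicLFunction_holds`, `Wuthrich2014.lemma20_surjective_threeAdic_of_semistable_holds`),
  the analytic-rank-`0` slice of crux 3 is EQUIVALENT to «`BSD(E,p)` at every X7 ∧ ¬CM ∧ `a_p = 0` ∧ Surj ∧
  `r_an = 0` pair» — the leaf's currency, no Iwasawa-theoretic content left (per pair this is the cell's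
  `X7.bsdp_iff_kobayashiLowerDivisibility_of_surj_of_analyticRank_eq_zero`, b2b-bsdres); the genuinely
  Λ-adic residue of crux 3 inside the cone of `closes` is its analytic-rank-`1` slice.
* §3 `kobayashiLowerHalfLargeImage_rankLeOne_of_engines` — the line's composition (`lowerHalf_of_engines` of
  the registered skeleton r2, b8007614) with the two CLASS-WIDE open stubs (`stub_kuriharaPartialInfty_le_tamagawa_X7`
  = the HARD stub, `stub_three`) each weakened by the trailing binder `W.analyticRank ≤ 1 →`, engines A/B and
  the `≥` stub verbatim: it yields the restricted crux, hence (§1) the leaf —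
  `signedSupersingular_of_engines_rankLeOne`. READING FOR THE PLANNER (split turnkey #1, children C1/C2):
  keying C1 (the HARD stub) and C2 (`stub_three`) to `W.analyticRank ≤ 1` loses nothing for `closes`, and at
  `r_an = 0` C1 is the leaf's rank-0 clause itself (line report v1/v2: O1 shrinks to its `r_an ≤ 1` rows; its
  `r_an = 0` rows are leaf-currency, its `r_an = 1` rows are the Λ-adic residue).

References: [Kobayashi2003] Thm. 1.2, Thm. 4.1, Conjecture (p. 2); [BDKim2013] Cor. 3.15;
[BurungaleKobayashiOta2023] Cor. A.5; [Wuthrich2014] Prop. 21, Lemma 20; [Miller2011LMS] Def. 1.1;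
[Kim2022StructureSelmer] Conj. 1.10, Thm. 1.11; [CastellaSano2026] Thm. 1.
-/

set_option autoImplicit false
-- the Theorems namespace of a single-conjunct summit repeats the summit name by design (D-0017)
set_option linter.dupNamespace false

noncomputable section

open scoped Classical MatrixGroups ModularForm

open CongruenceSubgroup WeierstrassCurve Literature.NumberTheory.EllipticCurves
  Literature.NumberTheory.EllipticCurves.ModularForms
  Literature.NumberTheory.EllipticCurves.Rank1Residual
  Literature.NumberTheory.EllipticCurves.Rank1Residual.Typed
  Summit.BirchSwinnertonDyer.Rank1Residual.Supersingular
  Summit.BirchSwinnertonDyer.BirchSwinnertonDyer.Theses.SignedLowerHalves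

namespace Summit.BirchSwinnertonDyer.BirchSwinnertonDyer.Theorems.LargeImageRankCut

/-! ### §1 The leaf needs crux 3 only at analytic rank `≤ 1` -/

/-- **Rung K3 assembled with crux 3 restricted to analytic rank `≤ 1`.** The leaf `SignedSupersingular`
follows from the route items `KobayashiLowerHalfSemistable`, `KobayashiMainConjectureSmallImage`,
`SprungLowerHalfAtThree`, `SharpFlatResiduePPart`, `PublishedSignedInputs` (by name) and the RESTRICTION of
`KobayashiLowerHalfLargeImage` to pairs with `W.analyticRank ≤ 1` (registered signature + one trailing binder).
Proof = the bridge `SignedSupersingular.signedSupersingular_of_lowerHalves` (p405667) re-run with the leaf's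
own rank bound fed to crux 3. CONDITIONAL bookkeeping; closes nothing.
[cite: Kobayashi2003, Thm. 1.2, Thm. 4.1 and Conjecture (p. 2)] [cite: Miller2011LMS, Def. 1.1] -/
theorem signedSupersingular_of_lowerHalves_largeImage_rankLeOne
    (hB1 : KobayashiLowerHalfSemistable)
    (hB2 : ∀ (W : WeierstrassCurve ℚ) [W.IsElliptic] [W.IsGloballyMinimal] (p : ℕ) [Fact p.Prime],
      p ≠ 2 → ClassX7 W p → ¬ W.HasCM → W.frobeniusTrace p = 0 → Surj W p → W.analyticRank ≤ 1 →
      ∃ ε : ℤˣ, KobayashiLowerDivisibility W p ε)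
    (hB2' : KobayashiMainConjectureSmallImage) (hB3 : SprungLowerHalfAtThree)
    (hR8 : SharpFlatResiduePPart) (hPub : PublishedSignedInputs) :
    Summit.BirchSwinnertonDyer.Rank1Residual.Supersingular.SignedSupersingular := by
  unfold KobayashiLowerHalfSemistable at hB1
  unfold KobayashiMainConjectureSmallImage at hB2'
  unfold SprungLowerHalfAtThree at hB3
  unfold SharpFlatResiduePPart at hR8
  unfold PublishedSignedInputs at hPub
  intro W _ _ p _ hr hcm hp
  obtain ⟨hW, h12, h41, hKim, hA5, h5, h3, hmodP, hmod, hGZK⟩ := hPub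
  haveI : Finite W.sha := (hGZK W hr).2
  have hPP := fun h ↦ Literature.NumberTheory.EllipticCurves.Rank1Residual.Typed.missingPPartAt_of_bsdp W p h
  have hLU := fun h ↦
    Literature.NumberTheory.EllipticCurves.Rank1Residual.Typed.lower_and_upper_of_missingPPartAt W p h
  have toX6 : Literature.NumberTheory.EllipticCurves.Rank1Residual.Typed.MissingPPartAt W p →
      Literature.NumberTheory.EllipticCurves.Rank1Residual.Typed.X6.MissingInputAt W p := fun h ↦
    ⟨fun _ _ _ ↦ (hLU h).1, fun _ ↦ h⟩
  have toX7 : Literature.NumberTheory.EllipticCurves.Rank1Residual.Typed.MissingPPartAt W p →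
      Literature.NumberTheory.EllipticCurves.Rank1Residual.Typed.X7.MissingInputAt W p := fun h ↦
    ⟨fun _ _ _ ↦ (hLU h).1, fun _ ↦ h⟩
  have toX8 : Literature.NumberTheory.EllipticCurves.Rank1Residual.Typed.MissingPPartAt W p →
      Literature.NumberTheory.EllipticCurves.Rank1Residual.Typed.X8.MissingInputAt W p := fun h ↦
    ⟨fun _ _ ↦ (hLU h).1, fun _ ↦ h⟩
  -- corner X8 (used twice: directly, and for the `a_3 = ±3` pairs of corner X7 at `p = 3`)
  have hX8 : Literature.NumberTheory.EllipticCurves.Rank1Residual.ClassX8 W p →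
      Literature.NumberTheory.EllipticCurves.Rank1Residual.Typed.X8.MissingInputAt W p := by
    intro hX
    by_cases hc : W.analyticRank = 0 ∧ Literature.NumberTheory.EllipticCurves.Rank1Residual.Surj W p
    · obtain ⟨N, _, f, ϖ, Lsharp, Lflat, c, ξ, hf, hϖ, hSP, hK, hdiv⟩ := hB3 W p hX
      exact Summit.BirchSwinnertonDyer.Rank1Residual.Supersingular.X8.missingInputAt_of_chromaticLowerDivisibility_of_surj
        W p hGZK hmod hX hc.2 hc.1 hf hϖ hSP c ξ hK hdiv
    · exact toX8 (hR8 W p hX hr hc)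
  refine ⟨fun hX _ ↦ ?_, fun hX ↦ ?_, hX8⟩
  · -- corner X6
    obtain ⟨ε, hlow⟩ := hB1 W p hp hX
    exact toX6 (hPP (Summit.BirchSwinnertonDyer.Rank1Residual.Supersingular.X6.bsdp_of_lowerDivisibility W p
      hW h12 h41 hKim hA5 h5 h3 hmodP hmod hGZK hp hX hr ε hlow))
  · -- corner X7
    by_cases hap : W.frobeniusTrace p = 0
    · by_cases hs : Literature.NumberTheory.EllipticCurves.Rank1Residual.Surj W p
      · -- THE ONLY CHANGE w.r.t. the bridge: crux 3 is fed the leaf's own bound `hr`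
        obtain ⟨ε, hlow⟩ := hB2 W p hp hX hcm hap hs hr
        exact toX7 (hPP (Summit.BirchSwinnertonDyer.Rank1Residual.Supersingular.X7.bsdp_of_lowerDivisibility_of_surj
          W p hW h12 h41 hKim hA5 h5 h3 hmodP hmod hGZK hp hX hap hs hr ε hlow))
      · obtain ⟨ε, hMC⟩ := hB2' W p hp hX hcm hap hs
        rcases Nat.le_one_iff_eq_zero_or_eq_one.mp hr with h0 | h1
        · exact toX7 (hPP (Summit.BirchSwinnertonDyer.Rank1Residual.Supersingular.bsdp_of_kobayashiMainConjecture_of_analyticRank_eq_zero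
            W p h12 hKim Literature.NumberTheory.EllipticCurves.pollack_exists_plusMinusPAdicLFunction_holds hmodP
            hmod hGZK hp hX.1.1 hap (Literature.NumberTheory.EllipticCurves.Rank1Residual.ClassX7.irr W p hp hX)
            h0 hMC))
        · exact toX7 (hPP (Summit.BirchSwinnertonDyer.Rank1Residual.Supersingular.X7.bsdp_of_kobayashiMainConjecture_of_corA5_of_analyticRank_eq_one
            W p hA5 hmod hGZK hp hX hap h1 ε hMC))
    · -- `a_p ≠ 0` at a good supersingular prime forces `p = 3`, `a_3 = ±3`: the pair is in corner X8
      have hp3 : p = 3 := by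
        by_contra h3'
        have hpr : p.Prime := Fact.out
        have h5p : 5 ≤ p := by
          have h2 := hpr.two_le
          have h4 : p ≠ 4 := by intro h4; rw [h4] at hpr; norm_num at hpr
          omega
        exact hap (Summit.BirchSwinnertonDyer.Rank1Residual.Supersingular.ClassX7.frobeniusTrace_eq_zero_of_five_le
          W p h5p hX)
      subst hp3
      have hX' : Literature.NumberTheory.EllipticCurves.Rank1Residual.ClassX8 W 3 := ⟨rfl, hX.1, hap⟩
      obtain ⟨hlow8, hpp8⟩ := hX8 hX'
      exact ⟨fun h0 _ himg ↦ hlow8 h0 himg, fun hc ↦ hpp8 (fun hc' ↦ hc ⟨hc'.1, hp, hc'.2⟩)⟩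

/-- Trivial converse bookkeeping: the route decl `KobayashiLowerHalfLargeImage` (crux 3, all analytic ranks)
implies its restriction to analytic rank `≤ 1`. [folklore] -/
theorem kobayashiLowerHalfLargeImage_rankLeOne_of_crux (h : KobayashiLowerHalfLargeImage) :
    ∀ (W : WeierstrassCurve ℚ) [W.IsElliptic] [W.IsGloballyMinimal] (p : ℕ) [Fact p.Prime],
      p ≠ 2 → ClassX7 W p → ¬ W.HasCM → W.frobeniusTrace p = 0 → Surj W p → W.analyticRank ≤ 1 →
      ∃ ε : ℤˣ, KobayashiLowerDivisibility W p ε := by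
  unfold KobayashiLowerHalfLargeImage at h
  intro W _ _ p _ hp hX hcm hap hs _hr
  exact h W p hp hX hcm hap hs

/-- Consistency check: the route's six items BY NAME give the leaf THROUGH the rank cut (crux 3 restricted by
`kobayashiLowerHalfLargeImage_rankLeOne_of_crux`, then `signedSupersingular_of_lowerHalves_largeImage_rankLeOne`) —
the same conclusion as `SignedLowerHalves.closes`, so the cut re-assembles the route. [folklore] -/
theorem signedSupersingular_of_items_via_rankCut (hB1 : KobayashiLowerHalfSemistable)
    (hB2 : KobayashiLowerHalfLargeImage) (hB2' : KobayashiMainConjectureSmallImage)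
    (hB3 : SprungLowerHalfAtThree) (hR8 : SharpFlatResiduePPart) (hPub : PublishedSignedInputs) :
    Summit.BirchSwinnertonDyer.Rank1Residual.Supersingular.SignedSupersingular :=
  signedSupersingular_of_lowerHalves_largeImage_rankLeOne hB1
    (kobayashiLowerHalfLargeImage_rankLeOne_of_crux hB2) hB2' hB3 hR8 hPub

/-- **The route's deciding shape with crux 3 cut to analytic rank `≤ 1`.** `Assembly`-shaped statement:
the five other route items by name and the restricted crux 3 imply the leaf. (Same content as
`signedSupersingular_of_lowerHalves_largeImage_rankLeOne`, displayed in the order of `SignedLowerHalves.closes`.)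
[folklore] -/
theorem closes_of_largeImage_rankLeOne :
    KobayashiLowerHalfSemistable →
    (∀ (W : WeierstrassCurve ℚ) [W.IsElliptic] [W.IsGloballyMinimal] (p : ℕ) [Fact p.Prime],
      p ≠ 2 → ClassX7 W p → ¬ W.HasCM → W.frobeniusTrace p = 0 → Surj W p → W.analyticRank ≤ 1 →
      ∃ ε : ℤˣ, KobayashiLowerDivisibility W p ε) →
    KobayashiMainConjectureSmallImage → SprungLowerHalfAtThree → SharpFlatResiduePPart →
    PublishedSignedInputs → Summit.BirchSwinnertonDyer.Rank1Residual.Supersingular.SignedSupersingular :=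
  fun hB1 hB2 hB2' hB3 hR8 hPub ↦
    signedSupersingular_of_lowerHalves_largeImage_rankLeOne hB1 hB2 hB2' hB3 hR8 hPub

/-! ### §2 The analytic-rank-`0` slice of crux 3 is the leaf's own currency -/

/-- **Rank-`0` slice of crux 3 ⟺ `BSD(E,p)` on the same pairs**, granted the route's support item
`PublishedSignedInputs` (Wuthrich Prop. 21, Kobayashi Thm. 1.2 / 4.1, B. D. Kim Cor. 3.15, the period facts,
modularity, GZK — by name) together with the tree THEOREMS for Pollack's `L^±` and Wuthrich's Lemma 20:
«∃ ε, `KobayashiLowerDivisibility W p ε` at every X7 ∧ ¬CM ∧ `a_p = 0` ∧ Surj ∧ `r_an = 0` pair» ⟺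
«`BSDp W p` at every such pair». Per pair this is `X7.bsdp_iff_kobayashiLowerDivisibility_of_surj_of_analyticRank_eq_zero`
(cell b2b-bsdres); here in class form with the route's names. CONDITIONAL; closes nothing.
[cite: Kobayashi2003, Thm. 1.2, Thm. 4.1 and Conjecture (p. 2)] [cite: BDKim2013, Cor. 3.15 (p. 199)]
[cite: Wuthrich2014, Prop. 21 (p. 400), Lemma 20 (p. 399)] [cite: Miller2011LMS, Def. 1.1] -/
theorem largeImage_rankZero_iff_bsdp (hPub : PublishedSignedInputs) :
    (∀ (W : WeierstrassCurve ℚ) [W.IsElliptic] [W.IsGloballyMinimal] (p : ℕ) [Fact p.Prime],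
      p ≠ 2 → ClassX7 W p → ¬ W.HasCM → W.frobeniusTrace p = 0 → Surj W p → W.analyticRank = 0 →
      ∃ ε : ℤˣ, KobayashiLowerDivisibility W p ε) ↔
    (∀ (W : WeierstrassCurve ℚ) [W.IsElliptic] [W.IsGloballyMinimal] (p : ℕ) [Fact p.Prime],
      p ≠ 2 → ClassX7 W p → ¬ W.HasCM → W.frobeniusTrace p = 0 → Surj W p → W.analyticRank = 0 →
      BSDp W p) := by
  unfold PublishedSignedInputs at hPub
  obtain ⟨hW, h12, h41, hKim, -, h5, h3, hmodP, hmod, hGZK⟩ := hPub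
  constructor
  · intro h W _ _ p _ hp hX hcm hap hs h0
    obtain ⟨ε, hε⟩ := h W p hp hX hcm hap hs h0
    exact (Summit.BirchSwinnertonDyer.Rank1Residual.Supersingular.X7.bsdp_iff_kobayashiLowerDivisibility_of_surj_of_analyticRank_eq_zero
      W p hW h12 h41 hKim Literature.NumberTheory.EllipticCurves.pollack_exists_plusMinusPAdicLFunction_holds
      hmodP hmod hGZK h5 h3 Wuthrich2014.lemma20_surjective_threeAdic_of_semistable_holds hp hX hap hs h0 ε).mpr hε
  · intro h W _ _ p _ hp hX hcm hap hs h0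
    exact ⟨1, (Summit.BirchSwinnertonDyer.Rank1Residual.Supersingular.X7.bsdp_iff_kobayashiLowerDivisibility_of_surj_of_analyticRank_eq_zero
      W p hW h12 h41 hKim Literature.NumberTheory.EllipticCurves.pollack_exists_plusMinusPAdicLFunction_holds
      hmodP hmod hGZK h5 h3 Wuthrich2014.lemma20_surjective_threeAdic_of_semistable_holds hp hX hap hs h0 1).mp
      (h W p hp hX hcm hap hs h0)⟩

/-- **The leaf from the rank-`0` slice in leaf currency plus the rank-`1` slice of crux 3.** Granted the five
other route items by name: «`BSDp` at every X7 ∧ ¬CM ∧ `a_p = 0` ∧ Surj ∧ `r_an = 0` pair» and «∃ ε,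
`KobayashiLowerDivisibility W p ε` at every such pair with `r_an = 1`» imply `SignedSupersingular`. So inside the
cone of `closes` the Λ-adic content of crux 3 is its analytic-rank-`1` slice. CONDITIONAL; closes nothing.
[cite: Kobayashi2003, Thm. 1.2, Thm. 4.1 and Conjecture (p. 2)] [cite: BurungaleKobayashiOta2023, Cor. A.5]
[cite: Miller2011LMS, Def. 1.1] -/
theorem signedSupersingular_of_rankZero_bsdp_of_rankOne_largeImage
    (hB1 : KobayashiLowerHalfSemistable)
    (h0 : ∀ (W : WeierstrassCurve ℚ) [W.IsElliptic] [W.IsGloballyMinimal] (p : ℕ) [Fact p.Prime],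
      p ≠ 2 → ClassX7 W p → ¬ W.HasCM → W.frobeniusTrace p = 0 → Surj W p → W.analyticRank = 0 →
      BSDp W p)
    (h1 : ∀ (W : WeierstrassCurve ℚ) [W.IsElliptic] [W.IsGloballyMinimal] (p : ℕ) [Fact p.Prime],
      p ≠ 2 → ClassX7 W p → ¬ W.HasCM → W.frobeniusTrace p = 0 → Surj W p → W.analyticRank = 1 →
      ∃ ε : ℤˣ, KobayashiLowerDivisibility W p ε)
    (hB2' : KobayashiMainConjectureSmallImage) (hB3 : SprungLowerHalfAtThree)
    (hR8 : SharpFlatResiduePPart) (hPub : PublishedSignedInputs) :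
    Summit.BirchSwinnertonDyer.Rank1Residual.Supersingular.SignedSupersingular := by
  refine signedSupersingular_of_lowerHalves_largeImage_rankLeOne hB1 ?_ hB2' hB3 hR8 hPub
  intro W _ _ p _ hp hX hcm hap hs hr
  rcases Nat.le_one_iff_eq_zero_or_eq_one.mp hr with hr0 | hr1
  · exact (largeImage_rankZero_iff_bsdp hPub).mpr h0 W p hp hX hcm hap hs hr0
  · exact h1 W p hp hX hcm hap hs hr1

/-! ### §3 The line `kurihara_rigidity` under the rank cut -/

/-- **The line's composition with its two class-wide open stubs cut to analytic rank `≤ 1`.** Verbatim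
`KuriharaRigidity.lowerHalf_of_engines` of the registered skeleton (r2, b8007614) except that the HARD stub
(`hLe`, the `≤` half of Kim's Conjecture 1.10 on X7 ∧ ¬CM ∧ `a_p = 0` ∧ Surj ∧ `p ≥ 5`) and the residue
`stub_three` (`h3`) carry the extra trailing binder `W.analyticRank ≤ 1 →`, and so does the conclusion:
engines A (`hA`, Kim Thm 1.11 ∘ Kobayashi Thm 7.4) and B (`hB`, Castella–Sano Thm 1 ∘ Kobayashi 7.4) and the
`≥` stub (`hGe`) are the registered statements unchanged. Pure logic over the stub statements.
[cite: Kim2022StructureSelmer, Conj. 1.10 and Thm. 1.11] [cite: CastellaSano2026, Thm. 1]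
[cite: Kobayashi2003, Thm. 7.4 (p. 13)] -/
theorem kobayashiLowerHalfLargeImage_rankLeOne_of_engines
    (hA : ∀ (W : WeierstrassCurve ℚ) [W.IsElliptic] [W.IsGloballyMinimal] (p : ℕ) [Fact p.Prime],
      5 ≤ p → W.HasGoodReductionAtPrime p → W.frobeniusTrace p = 0 → Surj W p →
      ¬ p ∣ W.tamagawaProduct →
      (∀ [NeZero (W.conductorNorm ℤ)] (f : CuspForm (Gamma0 (W.conductorNorm ℤ)) 2),
          IsNewformOf W f → kuriharaPartialInfty W p f = 0) →
      ∀ ε : ℤˣ, KobayashiMainConjecture W p ε)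
    (hB : ∀ (W : WeierstrassCurve ℚ) [W.IsElliptic] [W.IsGloballyMinimal] (p : ℕ) [Fact p.Prime],
      5 ≤ p → W.HasGoodReductionAtPrime p → W.frobeniusTrace p = 0 → ¬ W.HasCM → Surj W p →
      (∀ [NeZero (W.conductorNorm ℤ)] (f : CuspForm (Gamma0 (W.conductorNorm ℤ)) 2),
          IsNewformOf W f →
            kuriharaPartialInfty W p f = (padicValNat p W.tamagawaProduct : ℕ∞)) →
      ∀ ε : ℤˣ, KobayashiMainConjecture W p ε)
    (hLe : ∀ (W : WeierstrassCurve ℚ) [W.IsElliptic] [W.IsGloballyMinimal] (p : ℕ) [Fact p.Prime],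
      5 ≤ p → ClassX7 W p → ¬ W.HasCM → W.frobeniusTrace p = 0 → Surj W p →
      ∀ [NeZero (W.conductorNorm ℤ)] (f : CuspForm (Gamma0 (W.conductorNorm ℤ)) 2),
        IsNewformOf W f → W.analyticRank ≤ 1 →
          kuriharaPartialInfty W p f ≤ (padicValNat p W.tamagawaProduct : ℕ∞))
    (hGe : ∀ (W : WeierstrassCurve ℚ) [W.IsElliptic] [W.IsGloballyMinimal] (p : ℕ) [Fact p.Prime],
      5 ≤ p → ClassX7 W p → ¬ W.HasCM → W.frobeniusTrace p = 0 → Surj W p →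
      ∀ [NeZero (W.conductorNorm ℤ)] (f : CuspForm (Gamma0 (W.conductorNorm ℤ)) 2),
        IsNewformOf W f → (padicValNat p W.tamagawaProduct : ℕ∞) ≤ kuriharaPartialInfty W p f)
    (h3 : ∀ (W : WeierstrassCurve ℚ) [W.IsElliptic] [W.IsGloballyMinimal] (p : ℕ) [Fact p.Prime],
      p = 3 → ClassX7 W p → ¬ W.HasCM → W.frobeniusTrace p = 0 → Surj W p → W.analyticRank ≤ 1 →
      ∃ ε : ℤˣ, KobayashiLowerDivisibility W p ε) :
    ∀ (W : WeierstrassCurve ℚ) [W.IsElliptic] [W.IsGloballyMinimal] (p : ℕ) [Fact p.Prime],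
      p ≠ 2 → ClassX7 W p → ¬ W.HasCM → W.frobeniusTrace p = 0 → Surj W p → W.analyticRank ≤ 1 →
      ∃ ε : ℤˣ, KobayashiLowerDivisibility W p ε := by
  intro W _ _ p _ hp2 hX hcm hap hs hr
  have hpP : p.Prime := Fact.out
  by_cases hp5 : 5 ≤ p
  · have heq : ∀ [NeZero (W.conductorNorm ℤ)] (f : CuspForm (Gamma0 (W.conductorNorm ℤ)) 2),
        IsNewformOf W f →
          kuriharaPartialInfty W p f = (padicValNat p W.tamagawaProduct : ℕ∞) :=
      fun f hf => le_antisymm (hLe W p hp5 hX hcm hap hs f hf hr) (hGe W p hp5 hX hcm hap hs f hf)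
    by_cases htam : p ∣ W.tamagawaProduct
    · exact ⟨1, kobayashiLowerDivisibility_of_mainConjecture
        (hB W p hp5 hX.1.1 hap hcm hs (fun f hf => heq f hf) 1)⟩
    · have ht0 : padicValNat p W.tamagawaProduct = 0 :=
        padicValNat.eq_zero_of_not_dvd htam
      refine ⟨1, kobayashiLowerDivisibility_of_mainConjecture
        (hA W p hp5 hX.1.1 hap hs htam (fun f hf => ?_) 1)⟩
      have h := heq f hf
      rw [ht0] at h
      exact_mod_cast h
  · have hp3 : p = 3 := by
      have h2 := hpP.two_le
      interval_cases p
      · exact absurd rfl hp2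
      · rfl
      · exact absurd hpP (by decide)
    exact h3 W p hp3 hX hcm hap hs hr

/-- **The leaf from the line's engines with both open stubs cut to analytic rank `≤ 1`** (§3 ∘ §1): the five
other route items by name, engines A/B and the `≥` stub of line `kurihara_rigidity` as registered, the HARD
stub and `stub_three` each restricted to `W.analyticRank ≤ 1`, imply `SignedSupersingular`. This is the kernel
form of the lead's recommendation for the split of item 19001 (turnkey #1): children C1/C2 may be keyed to
analytic rank `≤ 1` without loss for `closes`. CONDITIONAL bookkeeping; closes nothing.
[cite: Kim2022StructureSelmer, Conj. 1.10 and Thm. 1.11] [cite: CastellaSano2026, Thm. 1]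
[cite: Kobayashi2003, Thm. 7.4 (p. 13)] -/
theorem signedSupersingular_of_engines_rankLeOne
    (hB1 : KobayashiLowerHalfSemistable) (hB2' : KobayashiMainConjectureSmallImage)
    (hB3 : SprungLowerHalfAtThree) (hR8 : SharpFlatResiduePPart) (hPub : PublishedSignedInputs)
    (hA : ∀ (W : WeierstrassCurve ℚ) [W.IsElliptic] [W.IsGloballyMinimal] (p : ℕ) [Fact p.Prime],
      5 ≤ p → W.HasGoodReductionAtPrime p → W.frobeniusTrace p = 0 → Surj W p →
      ¬ p ∣ W.tamagawaProduct →
      (∀ [NeZero (W.conductorNorm ℤ)] (f : CuspForm (Gamma0 (W.conductorNorm ℤ)) 2),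
          IsNewformOf W f → kuriharaPartialInfty W p f = 0) →
      ∀ ε : ℤˣ, KobayashiMainConjecture W p ε)
    (hB : ∀ (W : WeierstrassCurve ℚ) [W.IsElliptic] [W.IsGloballyMinimal] (p : ℕ) [Fact p.Prime],
      5 ≤ p → W.HasGoodReductionAtPrime p → W.frobeniusTrace p = 0 → ¬ W.HasCM → Surj W p →
      (∀ [NeZero (W.conductorNorm ℤ)] (f : CuspForm (Gamma0 (W.conductorNorm ℤ)) 2),
          IsNewformOf W f →
            kuriharaPartialInfty W p f = (padicValNat p W.tamagawaProduct : ℕ∞)) →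
      ∀ ε : ℤˣ, KobayashiMainConjecture W p ε)
    (hLe : ∀ (W : WeierstrassCurve ℚ) [W.IsElliptic] [W.IsGloballyMinimal] (p : ℕ) [Fact p.Prime],
      5 ≤ p → ClassX7 W p → ¬ W.HasCM → W.frobeniusTrace p = 0 → Surj W p →
      ∀ [NeZero (W.conductorNorm ℤ)] (f : CuspForm (Gamma0 (W.conductorNorm ℤ)) 2),
        IsNewformOf W f → W.analyticRank ≤ 1 →
          kuriharaPartialInfty W p f ≤ (padicValNat p W.tamagawaProduct : ℕ∞))
    (hGe : ∀ (W : WeierstrassCurve ℚ) [W.IsElliptic] [W.IsGloballyMinimal] (p : ℕ) [Fact p.Prime],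
      5 ≤ p → ClassX7 W p → ¬ W.HasCM → W.frobeniusTrace p = 0 → Surj W p →
      ∀ [NeZero (W.conductorNorm ℤ)] (f : CuspForm (Gamma0 (W.conductorNorm ℤ)) 2),
        IsNewformOf W f → (padicValNat p W.tamagawaProduct : ℕ∞) ≤ kuriharaPartialInfty W p f)
    (h3 : ∀ (W : WeierstrassCurve ℚ) [W.IsElliptic] [W.IsGloballyMinimal] (p : ℕ) [Fact p.Prime],
      p = 3 → ClassX7 W p → ¬ W.HasCM → W.frobeniusTrace p = 0 → Surj W p → W.analyticRank ≤ 1 →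
      ∃ ε : ℤˣ, KobayashiLowerDivisibility W p ε) :
    Summit.BirchSwinnertonDyer.Rank1Residual.Supersingular.SignedSupersingular :=
  signedSupersingular_of_lowerHalves_largeImage_rankLeOne hB1
    (kobayashiLowerHalfLargeImage_rankLeOne_of_engines hA hB hLe hGe h3) hB2' hB3 hR8 hPub

end Summit.BirchSwinnertonDyer.BirchSwinnertonDyer.Theorems.LargeImageRankCut

end
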